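import Mathlib
import HarnessLib

/-!
# LatticeQCDFlow / Scaling — the partition function on the diagonal `β√n = c`:
# `n·cgf(c/√n) → c²σ²/2` and `M(c/√n)^n → e^{c²σ²/2}` for a bounded centred statistic

HONEST FRAMING: exact (Metropolis-corrected) sampling algorithms for lattice gauge theory;
figures of merit are autocorrelation/cost numbers at stated couplings and volumes; no
continuum-physics claim.

Venture `LatticeQCDFlow` (cell pub-lqcd), topic `Scaling`; FANOUT row 3 (`s0-u1-a`, S0-B
implementation A, GEN-19).  NEW WORK of the cell (elementary, assembled on Mathlib's cumulant
generating function API: `analyticOnNhd_cgf`, the Lagrange form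
`exists_cgf_eq_iteratedDeriv_two_cgf_mul`, `variance_tilted_mul`, and Hoeffding's lemma
`hasSubgaussianMGF_of_mem_Icc_of_integral_eq_zero`); NO definition is introduced; nothing is cited.
It is the deterministic half of the diagonal scaling limit of the untrained factorised sampler
(`Scaling/IdentityFlowAcceptanceDiagonalLimit`): the free-energy term of the log weight,
`n·log M(c/√n)`, converges to `c²σ²/2`, half the limiting log-weight variance.

## Content (all `[ours]`), for `X` a.e. in `[a, b]` under a probability measure, centred

* `interior_integrableExpSet_eq_univ_of_mem_Icc`, `continuous_iteratedDeriv_two_cgf_of_mem_Icc`,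
  `iteratedDeriv_two_cgf_zero_of_mem_Icc` (`cgf″(0) = Var X`);
* **`tendsto_nat_mul_cgf_div_sqrt`** — `n·cgf(c/√n) → c²·Var X/2` for every real `c`;
* **`tendsto_mgf_div_sqrt_pow`** — `M(c/√n)^n → exp(c²·Var X/2)`;
* `mgf_div_sqrt_pow_le` — Hoeffding on the diagonal: `M(c/√n)^n ≤ exp(((b−a)/2)²c²/2)` for all `n`;
* **`tendsto_essFrac_diag`** — the Kish ESS fraction `(M(β)²/M(2β))^n` at `β = c/√n` → `e^{−c²σ²}`;
  **`tendsto_bhattacharyyaCeiling_diag`** — the acceptance ceiling `(M(β/2)²/M(β))^n` → `e^{−c²σ²/4}`: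
  with `Scaling/IdentityFlowAcceptanceDiagonalLimit` (`acc → erfc(|c|σ/2)`) the three figures of merit
  of the untrained sampler on the diagonal are EXACTLY those of the log-normal weight model with
  `s = c²σ²` (`ESS = e^{−s}`, `ā = erfc(√s/2) ≤ BC² = e^{−s/4}`).

NOT CLAIMED: unbounded statistics (an open `integrableExpSet` around `0` would suffice); rates.
-/

noncomputable section

namespace Summit.Ventures.LatticeQCDFlow.Theory2

open MeasureTheory ProbabilityTheory Filter Finset Real Set
open scoped Topology NNReal

/-! ## §2 The partition function on the diagonal: `M(c/√n)^n → e^{c²σ²/2}` -/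

section Denominator

variable {Ω : Type*} {mΩ : MeasurableSpace Ω} {μ : Measure Ω} [IsProbabilityMeasure μ] {X : Ω → ℝ}

/-- For a bounded statistic every exponential moment exists: `integrableExpSet = univ`. [ours] -/
theorem interior_integrableExpSet_eq_univ_of_mem_Icc {a b : ℝ} (hm : AEMeasurable X μ)
    (hb : ∀ᵐ ω ∂μ, X ω ∈ Set.Icc a b) : interior (integrableExpSet X μ) = Set.univ := by
  have hi : ∀ u : ℝ, Integrable (fun ω => Real.exp (u * X ω)) μ := fun u =>
    integrable_exp_mul_of_mem_Icc hm hb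
  have : integrableExpSet X μ = Set.univ := Set.eq_univ_of_forall fun u => hi u
  rw [this, interior_univ]

/-- `cgf″` of a bounded statistic is continuous (indeed analytic) everywhere. [ours] -/
theorem continuous_iteratedDeriv_two_cgf_of_mem_Icc {a b : ℝ} (hm : AEMeasurable X μ)
    (hb : ∀ᵐ ω ∂μ, X ω ∈ Set.Icc a b) : Continuous (iteratedDeriv 2 (cgf X μ)) := by
  have han : AnalyticOnNhd ℝ (cgf X μ) Set.univ := by
    rw [← interior_integrableExpSet_eq_univ_of_mem_Icc hm hb]
    exact analyticOnNhd_cgf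
  have h2 := han.iterated_deriv 2
  rw [← iteratedDeriv_eq_iterate] at h2
  exact continuousOn_univ.1 h2.continuousOn

/-- `cgf″(0) = Var X` for a bounded statistic. [ours] (Mathlib's `variance_tilted_mul` at `0`) -/
theorem iteratedDeriv_two_cgf_zero_of_mem_Icc {a b : ℝ} (hm : AEMeasurable X μ)
    (hb : ∀ᵐ ω ∂μ, X ω ∈ Set.Icc a b) : iteratedDeriv 2 (cgf X μ) 0 = Var[X; μ] := by
  have h0 : (0 : ℝ) ∈ interior (integrableExpSet X μ) := by
    rw [interior_integrableExpSet_eq_univ_of_mem_Icc hm hb]; exact Set.mem_univ _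
  rw [← variance_tilted_mul h0]
  simp only [zero_mul]
  rw [show (fun _ : Ω => (0 : ℝ)) = (0 : Ω → ℝ) from rfl, tilted_zero]

/-- **`n·cgf(c/√n) → c²σ²/2`** for a bounded centred statistic, `c ≥ 0`. [ours] -/
theorem tendsto_nat_mul_cgf_div_sqrt_of_nonneg {a b : ℝ} (hm : AEMeasurable X μ)
    (hb : ∀ᵐ ω ∂μ, X ω ∈ Set.Icc a b) (hc : μ[X] = 0) {c : ℝ} (hc0 : 0 ≤ c) :
    Tendsto (fun n : ℕ => (n : ℝ) * cgf X μ (c / Real.sqrt n)) atTop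
      (𝓝 (c ^ 2 * Var[X; μ] / 2)) := by
  rcases hc0.eq_or_lt with hz | hcpos
  · subst hz
    simp only [zero_div, cgf_zero, mul_zero, ne_eq, OfNat.ofNat_ne_zero, not_false_eq_true,
      zero_pow, zero_mul]
    exact tendsto_const_nhds
  have hint : interior (integrableExpSet X μ) = Set.univ :=
    interior_integrableExpSet_eq_univ_of_mem_Icc hm hb
  -- Lagrange form at order two, for each `n ≥ 1`
  have hL : ∀ n : ℕ, 0 < n → ∃ u ∈ Set.Ioo 0 (c / Real.sqrt n),
      cgf X μ (c / Real.sqrt n) = iteratedDeriv 2 (cgf X μ) u * (c / Real.sqrt n) ^ 2 / 2 := by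
    intro n hn
    have ht : 0 < c / Real.sqrt n := div_pos hcpos (Real.sqrt_pos.2 (Nat.cast_pos.2 hn))
    exact exists_cgf_eq_iteratedDeriv_two_cgf_mul ht hc (by rw [hint]; exact Set.subset_univ _)
  classical
  -- choose the intermediate points
  let u : ℕ → ℝ := fun n => if hn : 0 < n then (hL n hn).choose else 0
  have hu_mem : ∀ n : ℕ, 0 < n → u n ∈ Set.Ioo 0 (c / Real.sqrt n) := fun n hn => by
    simp only [u, hn, ↓reduceDIte]; exact (hL n hn).choose_spec.1
  have hu_eq : ∀ n : ℕ, 0 < n →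
      cgf X μ (c / Real.sqrt n) = iteratedDeriv 2 (cgf X μ) (u n) * (c / Real.sqrt n) ^ 2 / 2 :=
    fun n hn => by simp only [u, hn, ↓reduceDIte]; exact (hL n hn).choose_spec.2
  -- `u n → 0`
  have hcn : Tendsto (fun n : ℕ => c / Real.sqrt n) atTop (𝓝 0) := by
    have := (tendsto_inv_atTop_zero.comp
      (Real.tendsto_sqrt_atTop.comp tendsto_natCast_atTop_atTop)).const_mul c
    simpa [div_eq_mul_inv] using this
  have hu0 : Tendsto u atTop (𝓝 0) := by
    refine tendsto_of_tendsto_of_tendsto_of_le_of_le' tendsto_const_nhds hcn ?_ ?_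
    · filter_upwards [eventually_gt_atTop 0] with n hn using (hu_mem n hn).1.le
    · filter_upwards [eventually_gt_atTop 0] with n hn using (hu_mem n hn).2.le
  -- continuity of `cgf″` at `0`
  have hcont := (continuous_iteratedDeriv_two_cgf_of_mem_Icc hm hb).continuousAt (x := (0 : ℝ))
  have hlim : Tendsto (fun n => iteratedDeriv 2 (cgf X μ) (u n)) atTop (𝓝 (Var[X; μ])) := by
    rw [← iteratedDeriv_two_cgf_zero_of_mem_Icc hm hb]
    exact hcont.tendsto.comp hu0
  have hlim2 := hlim.mul_const (c ^ 2 / 2)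
  rw [show Var[X; μ] * (c ^ 2 / 2) = c ^ 2 * Var[X; μ] / 2 by ring] at hlim2
  refine hlim2.congr' ?_
  filter_upwards [eventually_gt_atTop 0] with n hn
  rw [hu_eq n hn]
  have hn' : (0 : ℝ) < n := Nat.cast_pos.2 hn
  rw [div_pow, Real.sq_sqrt hn'.le]
  field_simp

/-- **`n·cgf(c/√n) → c²σ²/2`** for a bounded centred statistic, every real `c`. [ours] -/
theorem tendsto_nat_mul_cgf_div_sqrt {a b : ℝ} (hm : AEMeasurable X μ)
    (hb : ∀ᵐ ω ∂μ, X ω ∈ Set.Icc a b) (hc : μ[X] = 0) (c : ℝ) :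
    Tendsto (fun n : ℕ => (n : ℝ) * cgf X μ (c / Real.sqrt n)) atTop
      (𝓝 (c ^ 2 * Var[X; μ] / 2)) := by
  rcases le_or_gt 0 c with hc0 | hc0
  · exact tendsto_nat_mul_cgf_div_sqrt_of_nonneg hm hb hc hc0
  · -- `c < 0`: pass to `−X`
    have hm' : AEMeasurable (-X) μ := hm.neg
    have hb' : ∀ᵐ ω ∂μ, (-X) ω ∈ Set.Icc (-b) (-a) := by
      filter_upwards [hb] with ω hω
      simp only [Pi.neg_apply, Set.mem_Icc, neg_le_neg_iff]
      exact ⟨hω.2, hω.1⟩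
    have hc' : μ[-X] = 0 := by
      simp only [Pi.neg_apply, integral_neg, hc, neg_zero]
    have h := tendsto_nat_mul_cgf_div_sqrt_of_nonneg hm' hb' hc' (neg_nonneg.2 hc0.le)
    rw [variance_neg, neg_sq] at h
    refine h.congr fun n => ?_
    rw [cgf_neg, neg_div, neg_neg]

/-- **THE PARTITION FUNCTION ON THE DIAGONAL**: `M(c/√n)^n → exp(c²σ²/2)`. [ours] -/
theorem tendsto_mgf_div_sqrt_pow {a b : ℝ} (hm : AEMeasurable X μ)
    (hb : ∀ᵐ ω ∂μ, X ω ∈ Set.Icc a b) (hc : μ[X] = 0) (c : ℝ) :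
    Tendsto (fun n : ℕ => mgf X μ (c / Real.sqrt n) ^ n) atTop
      (𝓝 (Real.exp (c ^ 2 * Var[X; μ] / 2))) := by
  have hi : ∀ u : ℝ, Integrable (fun ω => Real.exp (u * X ω)) μ := fun u =>
    integrable_exp_mul_of_mem_Icc hm hb
  have h := (Real.continuous_exp.tendsto _).comp (tendsto_nat_mul_cgf_div_sqrt hm hb hc c)
  refine h.congr fun n => ?_
  simp only [Function.comp_apply]
  rw [← exp_cgf (hi _), ← Real.exp_nat_mul]

/-- Hoeffding's bound on the diagonal: `M(c/√n)^n ≤ exp(((b−a)/2)²c²/2)` for every `n`. [ours] -/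
theorem mgf_div_sqrt_pow_le {a b : ℝ} (hm : AEMeasurable X μ)
    (hb : ∀ᵐ ω ∂μ, X ω ∈ Set.Icc a b) (hc : μ[X] = 0) (c : ℝ) (n : ℕ) :
    mgf X μ (c / Real.sqrt n) ^ n ≤ Real.exp ((‖b - a‖₊ / 2) ^ 2 * c ^ 2 / 2) := by
  have hH := (hasSubgaussianMGF_of_mem_Icc_of_integral_eq_zero hm hb hc).mgf_le (c / Real.sqrt n)
  have h0 : 0 ≤ mgf X μ (c / Real.sqrt n) := mgf_nonneg
  rcases Nat.eq_zero_or_pos n with hn | hn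
  · subst hn
    simp only [pow_zero]
    exact Real.one_le_exp (by positivity)
  calc mgf X μ (c / Real.sqrt n) ^ n
      ≤ Real.exp (((‖b - a‖₊ / 2) ^ 2 * (c / Real.sqrt n) ^ 2 / 2)) ^ n :=
        pow_le_pow_left₀ h0 hH n
    _ = Real.exp ((‖b - a‖₊ / 2) ^ 2 * c ^ 2 / 2) := by
        rw [← Real.exp_nat_mul, div_pow c, Real.sq_sqrt (Nat.cast_nonneg n)]
        congr 1
        field_simp

/-- **THE ESS FRACTION ON THE DIAGONAL**: `(M(c/√n)²/M(2c/√n))^n → exp(−c²σ²)` — the Kish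
effective-sample-size fraction `(E w)²/E w²` of the untrained `n`-block sampler at `β = c/√n`
converges to the log-normal model's value `e^{−s}`, `s = c²σ²`. [ours] -/
theorem tendsto_essFrac_diag {a b : ℝ} (hm : AEMeasurable X μ)
    (hb : ∀ᵐ ω ∂μ, X ω ∈ Set.Icc a b) (hc : μ[X] = 0) (c : ℝ) :
    Tendsto (fun n : ℕ => (mgf X μ (c / Real.sqrt n) ^ 2 / mgf X μ (2 * c / Real.sqrt n)) ^ n) atTop
      (𝓝 (Real.exp (-(c ^ 2 * Var[X; μ])))) := by
  have h1 := tendsto_mgf_div_sqrt_pow hm hb hc c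
  have h2 := tendsto_mgf_div_sqrt_pow hm hb hc (2 * c)
  have h := (h1.pow 2).div h2 (Real.exp_pos _).ne'
  have e : Real.exp (c ^ 2 * Var[X; μ] / 2) ^ 2 / Real.exp ((2 * c) ^ 2 * Var[X; μ] / 2)
      = Real.exp (-(c ^ 2 * Var[X; μ])) := by
    rw [← Real.exp_nat_mul, ← Real.exp_sub]
    congr 1
    ring
  rw [e] at h
  refine h.congr fun n => ?_
  simp only [Pi.div_apply]
  rw [div_pow, ← pow_mul, ← pow_mul, mul_comm n 2]

/-- **THE BHATTACHARYYA CEILING ON THE DIAGONAL**: `(M(c/(2√n))²/M(c/√n))^n → exp(−c²σ²/4)` — the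
ceiling `BC²ⁿ` of the acceptance (row 3's `Scaling/AcceptanceVolumeCeilingPi`) at `β = c/√n`
converges to `e^{−s/4}`, `s = c²σ²`. [ours] -/
theorem tendsto_bhattacharyyaCeiling_diag {a b : ℝ} (hm : AEMeasurable X μ)
    (hb : ∀ᵐ ω ∂μ, X ω ∈ Set.Icc a b) (hc : μ[X] = 0) (c : ℝ) :
    Tendsto (fun n : ℕ => (mgf X μ (c / 2 / Real.sqrt n) ^ 2 / mgf X μ (c / Real.sqrt n)) ^ n) atTop
      (𝓝 (Real.exp (-(c ^ 2 * Var[X; μ] / 4)))) := by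
  have h1 := tendsto_mgf_div_sqrt_pow hm hb hc (c / 2)
  have h2 := tendsto_mgf_div_sqrt_pow hm hb hc c
  have h := (h1.pow 2).div h2 (Real.exp_pos _).ne'
  have e : Real.exp ((c / 2) ^ 2 * Var[X; μ] / 2) ^ 2 / Real.exp (c ^ 2 * Var[X; μ] / 2)
      = Real.exp (-(c ^ 2 * Var[X; μ] / 4)) := by
    rw [← Real.exp_nat_mul, ← Real.exp_sub]
    congr 1
    ring
  rw [e] at h
  refine h.congr fun n => ?_
  simp only [Pi.div_apply]
  rw [div_pow, ← pow_mul, ← pow_mul, mul_comm n 2]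

end Denominator

end Summit.Ventures.LatticeQCDFlow.Theory2

end
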